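import Literature.NumberTheory.EllipticCurves.CMFormalActionNilIdealPointsY
import Literature.NumberTheory.EllipticCurves.DeShalitThetaTExpansionColemanValues
import HarnessLib

/-!
# (CM-POINTS)(ii) packaged: the formal CM action `t ↦ T(t)` on `E₁(K)` IS the algebraic chart `(x, y) ↦ (R(x), …)` —
# `P₁^α ⊕ P(T t) = Z` as POINTS, from the `x`- and `y`-identities at the translate (de Shalit II.1.10 / II.4.9 (ii) — proofs only)

Topic `NumberTheory/EllipticCurves` (theorems only; no definition, no named fact, no instance).  Sequel of `CMFormalActionNilIdealPoints`
(CMF-pt: the `x`-identity `(x(P₁^α ⊕ P(T t)) + b)·Q(x(P₁ ⊕ P t) + b) = P(x(P₁ ⊕ P t) + b)` at every `t ∈ 𝔪_K`) and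
`CMFormalActionNilIdealPointsY` (CM-ptY: the `y`-shape identity).  Cell `bsd-print-cf2`, seat `bsd-line-cf2c-w4` g15, piece (α) of the
`j = 0` seam: the levelwise chart identity (he) of `relColemanSeries_eq_subst_subst_of_forall_sub_ptOfZ_eq` needs de Shalit's torsion points
`U_n` to be COHERENT under the formal multiplication `T = [ψ(𝔭)]_Ê` — i.e. that `P(T(z(U)))` is the algebraic point `[ψ(𝔭)]U`.  This file
turns the two coordinate identities into ONE identity of points of `E(K)`:

* §0 `evalAt` bookkeeping: `coe_eval₂_map_subtype` (the `K`-valued polynomial values of CMF-pt as `Polynomial.eval₂` along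
  `φ = (𝒪_K ↪ K) ∘ algebraMap`);
* §1 `some_sub_some_eq_some_iff` (an affine difference in coordinates: non-degeneracy + Mathlib's `addX`/`addY`),
  ★ `some_sub_ptOfZ_eq_some_iff_of_map_algebraMap_eq` — the chart identity `P₀ − P(t) = (x_R, y_R)` is the SAME statement on the
  curves of two presentations `W₁/A₁`, `W₂/A₂` with one integral model over `𝒪_K` (e.g. the lane's `V ⊗ LTCoeff F` and the theta
  datum's `W_R`): the (e)-assembler proves (he) on the `R`-presentation (where CMF-pt lives) and transports it to the lane curve;
* §2 ★★★ `some_add_ptOfZ_evalPt₁_eq_of_cm_identities` — **`P₁^α ⊕ P(T t) = Z`**: for `A`-points `P₁ = (x₀, y₀)`, `P₁^α = (x₁, y₁)`, a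
  constant-term-free `T ∈ A⟦X⟧`, polynomials `P, Q ∈ A[X]`, a scalar `α` and shift `b` satisfying the `x`- and `y`-shape series
  identities (CMF-pt's `hid`, CM-ptY's `hid` for the translate series), a parameter `t ≠ 0` with `T t ≠ 0`, the point
  `P₁ ⊕ P(t) = (X₀, Y₀)` and a nonsingular `Z = (x_Z, y_Z)` whose coordinates satisfy THE SAME two identities with `(X₀, Y₀)`
  (`(x_Z + b)·Q(X₀ + b) = P(X₀ + b)` and the `y`-shape one) and `Q(X₀ + b) ≠ 0`, `α ≠ 0`, `2 ≠ 0`: then `P₁^α ⊕ P(T t) = Z`; and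
  `ptOfZ_evalPt₁_eq_sub_of_cm_identities` — `P(T t) = Z − P₁^α`.  With `Z = ι_v ξ(α(Ω₁ + u))` (whose coordinates satisfy the identities by the
  complex certificate `℘(αz) = (P/Q)(℘ z)`, `℘′(αz) = α⁻¹R′(℘ z)℘′(z)`) and `P₁ ⊕ P(t) = ι_v ξ(Ω₁ + u)`: **`P(T(z(ι_v ξ u))) = ι_v ξ(αu)`**,
  the coherence input of (TG) `exists_unit_forall_coe_ltAct_cohPt_eq`.

No summit statement is proved; BSD is not proved by any of this.

## References
* [deShalit1987] E. de Shalit, *Iwasawa theory of elliptic curves with complex multiplication* (1987), II §1.10, II §4.4 (iv), II §4.9 (ii).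
* [SilvermanATAEC1994] J. H. Silverman, *Advanced Topics in the Arithmetic of Elliptic Curves* (1994), II Prop. 1.1, §II.2.
* [SilvermanAEC2009] J. H. Silverman, *The Arithmetic of Elliptic Curves*, 2nd ed. (2009), III.2.3, VII.2.2.
-/

noncomputable section

open scoped Classical
open PowerSeries

namespace Literature.NumberTheory.EllipticCurves

open Literature.NumberTheory.GaloisRepresentations Literature.NumberTheory.GaloisRepresentations.LubinTate
open Literature.NumberTheory.EllipticCurves.FormalGroupChart _root_.WeierstrassCurve

/-! ## §0 Polynomial values along `φ = (𝒪_K ↪ K) ∘ algebraMap` -/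

section Eval

variable {A : Type*} [CommRing A] {K : Type*} [NontriviallyNormedField K] [IsUltrametricDist K] [Algebra A (unitBall K)]

/-- `((p.map algebraMap).eval₂ (𝒪_K ↪ K)) u = p.eval₂ φ u` with `φ = (𝒪_K ↪ K) ∘ algebraMap` (Mathlib `eval₂_map`).
[cite: SilvermanAEC2009, VII.1] -/
theorem coe_eval₂_map_subtype (p : Polynomial A) (u : K) :
    (p.map (algebraMap A (unitBall K))).eval₂ (unitBall K).subtype u =
      p.eval₂ ((unitBall K).subtype.comp (algebraMap A (unitBall K))) u :=
  Polynomial.eval₂_map _ _ _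

/-- `cK K a = φ a`. [cite: SilvermanAEC2009, VII.1] -/
theorem cK_eq_comp_apply (a : A) : cK K a = ((unitBall K).subtype.comp (algebraMap A (unitBall K))) a := rfl

end Eval

/-! ## §1 Chart identities across two presentations of one curve -/

section Presentation

/-- **An affine difference in coordinates**: `(x₁, y₁) − (x₂, y₂) = (x₃, y₃)` iff the difference is not `O` (`(x₁, y₁) ≠ (x₂, y₂)`) and
`(x₃, y₃)` is Mathlib's `(addX, addY)` at the slope through `(x₁, y₁)` and `−(x₂, y₂) = (x₂, negY x₂ y₂)`.  The `DecidableEq` instance of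
Mathlib's addition is an implicit ARGUMENT (unified from the statement). [cite: SilvermanAEC2009, III.2.3] -/
theorem some_sub_some_eq_some_iff {K : Type*} [Field K] {dec : DecidableEq K} {C : WeierstrassCurve K} {x₁ y₁ x₂ y₂ x₃ y₃ : K}
    {h₁ : C.toAffine.Nonsingular x₁ y₁} {h₂ : C.toAffine.Nonsingular x₂ y₂} {h₃ : C.toAffine.Nonsingular x₃ y₃} :
    (.some x₁ y₁ h₁ : C.toAffine.Point) - .some x₂ y₂ h₂ = .some x₃ y₃ h₃ ↔
      ¬ (x₁ = x₂ ∧ y₁ = C.toAffine.negY x₂ (C.toAffine.negY x₂ y₂)) ∧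
        x₃ = C.toAffine.addX x₁ x₂ (C.toAffine.slope x₁ x₂ y₁ (C.toAffine.negY x₂ y₂)) ∧
        y₃ = C.toAffine.addY x₁ x₂ y₁ (C.toAffine.slope x₁ x₂ y₁ (C.toAffine.negY x₂ y₂)) := by
  rw [sub_eq_add_neg, Affine.Point.neg_some]
  by_cases hxy : x₁ = x₂ ∧ y₁ = C.toAffine.negY x₂ (C.toAffine.negY x₂ y₂)
  · rw [Affine.Point.add_of_Y_eq hxy.1 hxy.2]
    exact ⟨fun h => absurd h.symm (Affine.Point.some_ne_zero _), fun h => absurd hxy h.1⟩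
  · rw [Affine.Point.add_some hxy]
    simp only [Affine.Point.some.injEq, hxy, not_false_eq_true, true_and]
    exact ⟨fun h => ⟨h.1.symm, h.2.symm⟩, fun h => ⟨h.1.symm, h.2.symm⟩⟩

variable {A₁ : Type*} [CommRing A₁] [UniformSpace A₁] [DiscreteUniformity A₁]
  {A₂ : Type*} [CommRing A₂] [UniformSpace A₂] [DiscreteUniformity A₂]
  {K : Type*} [NontriviallyNormedField K] [IsUltrametricDist K] [CompleteSpace K]
  [Algebra A₁ (unitBall K)] [ContinuousSMul A₁ (unitBall K)] [Algebra A₂ (unitBall K)] [ContinuousSMul A₂ (unitBall K)]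
  {W₁ : WeierstrassCurve A₁} {W₂ : WeierstrassCurve A₂}

/-- ★ **The chart identity `P₀ − P(t) = (x_R, y_R)` across presentations** (both coordinates, both directions): for `W₁/A₁`, `W₂/A₂`
with the same integral model over `𝒪_K`, the identity holds on the curve of the first presentation iff it holds on the curve of the
second (the curves coincide, `curveOver_eq_of_map_algebraMap_eq`; the formal points have the same coordinates, `evX_eq_of_map_algebraMap_eq`;
§1 `some_sub_some_eq_some_iff`).  The (e)-assembler proves (he) of `relColemanSeries_eq_subst_subst_of_forall_sub_ptOfZ_eq` on the
presentation carrying the theta datum (§2) and transports it to the lane curve `V ⊗ LTCoeff F` with this.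
[cite: deShalit1987, II §4.9 Proposition (ii)] [cite: SilvermanAEC2009, III.2.3, VII.2.2] -/
theorem some_sub_ptOfZ_eq_some_iff_of_map_algebraMap_eq {dec : DecidableEq K} [(curveOver K W₁).IsElliptic] [(curveOver K W₂).IsElliptic]
    (h : W₁.map (algebraMap A₁ (unitBall K)) = W₂.map (algebraMap A₂ (unitBall K))) {X₀ Y₀ xR yR : K}
    {h₀ : (curveOver K W₁).toAffine.Nonsingular X₀ Y₀} {h₀' : (curveOver K W₂).toAffine.Nonsingular X₀ Y₀}
    {hR : (curveOver K W₁).toAffine.Nonsingular xR yR} {hR' : (curveOver K W₂).toAffine.Nonsingular xR yR}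
    (t : (ballNilIdeal K).toIdeal) :
    (.some X₀ Y₀ h₀ : (curveOver K W₁).toAffine.Point) - ptOfZ K W₁ t = .some xR yR hR ↔
      (.some X₀ Y₀ h₀' : (curveOver K W₂).toAffine.Point) - ptOfZ K W₂ t = .some xR yR hR' := by
  have hC := curveOver_eq_of_map_algebraMap_eq (K := K) h
  have hX := evX_eq_of_map_algebraMap_eq (K := K) h t
  by_cases ht0 : ((t : unitBall K) : K) = 0
  · rw [ptOfZ_of_eq_zero ht0, ptOfZ_of_eq_zero ht0, sub_zero, sub_zero]
    simp only [Affine.Point.some.injEq]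
  · rw [ptOfZ_of_ne_zero ht0, ptOfZ_of_ne_zero ht0, some_sub_some_eq_some_iff, some_sub_some_eq_some_iff, hX, hC]

end Presentation

/-! ## §2 `P₁^α ⊕ P(T t) = Z` from the two coordinate identities -/

section Chart

variable {A : Type*} [CommRing A] [UniformSpace A] [DiscreteUniformity A]
  {K : Type*} [NontriviallyNormedField K] [IsUltrametricDist K] [CompleteSpace K]
  [Algebra A (unitBall K)] [ContinuousSMul A (unitBall K)] {W : WeierstrassCurve A} [hE : (curveOver K W).IsElliptic]

set_option maxHeartbeats 800000 in
/-- ★★★ **(CM-POINTS)(ii) packaged: `P₁^α ⊕ P(T t) = Z`.**  Let `P₁ = (x₀, y₀)`, `P₁^α = (x₁, y₁)` be `A`-points, `T ∈ A⟦X⟧` without constant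
term, `P, Q ∈ A[X]`, `α, b ∈ A` with the `x`-identity (hidX) `(translateX(x₁,y₁) ∘ T + b)·Q(translateX(x₀,y₀) + b) = P(translateX(x₀,y₀) + b)`
and the `y`-shape identity (hidY) of `CMFormalActionNilIdealPointsY` for the translate series.  Let `t ∈ 𝔪_K` with `t ≠ 0`, `T(t) ≠ 0`,
`P₁ ⊕ P(t) = (X₀, Y₀)`, and let `Z = (x_Z, y_Z)` be a nonsingular point whose coordinates satisfy, with `φ = (𝒪_K ↪ K) ∘ algebraMap` and
`ỹ = 2y + a₁x + a₃`: `(x_Z + φb)·Q^φ(X₀ + φb) = P^φ(X₀ + φb)` and `φα·ỹ_Z·Q^φ(X₀ + φb) + (x_Z + φb)·(Q′)^φ(X₀ + φb)·Ỹ₀ = (P′)^φ(X₀ + φb)·Ỹ₀`,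
with `Q^φ(X₀ + φb) ≠ 0`, `φα ≠ 0`, `2 ≠ 0` in `K`.  THEN **`P₁^α ⊕ P(T t) = Z`**: CMF-pt and CM-ptY say that the coordinates of `P₁^α ⊕ P(T t)`
satisfy the same two identities, which determine `x` (cancel `Q ≠ 0`) and then `ỹ` (cancel `αQ ≠ 0`), hence `y`.
[cite: deShalit1987, II §1.10, II §4.9 Proposition (ii)] [cite: SilvermanATAEC1994, II Prop. 1.1] -/
theorem some_add_ptOfZ_evalPt₁_eq_of_cm_identities {x₀ y₀ x₁ y₁ b α : A} {T : PowerSeries A} (hT : constantCoeff T = 0)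
    {P Q : Polynomial A}
    (hidX : ((W.translateX x₁ y₁).subst T + C b) * Polynomial.aeval (W.translateX x₀ y₀ + C b) Q =
      Polynomial.aeval (W.translateX x₀ y₀ + C b) P)
    (hidY : C α * (2 * PowerSeries.subst T (W.translateY x₁ y₁) + C W.a₁ * PowerSeries.subst T (W.translateX x₁ y₁) + C W.a₃) *
          Polynomial.aeval (W.translateX x₀ y₀ + C b) Q +
        (PowerSeries.subst T (W.translateX x₁ y₁) + C b) * Polynomial.aeval (W.translateX x₀ y₀ + C b) (Polynomial.derivative Q) *
          (2 * W.translateY x₀ y₀ + C W.a₁ * W.translateX x₀ y₀ + C W.a₃) =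
      Polynomial.aeval (W.translateX x₀ y₀ + C b) (Polynomial.derivative P) *
        (2 * W.translateY x₀ y₀ + C W.a₁ * W.translateX x₀ y₀ + C W.a₃))
    (h₀ : (curveOver K W).toAffine.Nonsingular (cK K x₀) (cK K y₀)) (h₁ : (curveOver K W).toAffine.Nonsingular (cK K x₁) (cK K y₁))
    {t : (ballNilIdeal K).toIdeal} (ht0 : ((t : unitBall K) : K) ≠ 0)
    (hTt0 : (((evalPt₁ (ballNilIdeal K) T hT t : (ballNilIdeal K).toIdeal) : unitBall K) : K) ≠ 0)
    {X₀ Y₀ : K} {hS : (curveOver K W).toAffine.Nonsingular X₀ Y₀}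
    (hsum : (.some (cK K x₀) (cK K y₀) h₀ : (curveOver K W).toAffine.Point) + ptOfZ K W t = .some X₀ Y₀ hS)
    {xZ yZ : K} (hZ : (curveOver K W).toAffine.Nonsingular xZ yZ)
    (hQ : Q.eval₂ ((unitBall K).subtype.comp (algebraMap A (unitBall K))) (X₀ + cK K b) ≠ 0)
    (hα : cK K α ≠ 0) (h2 : (2 : K) ≠ 0)
    (hZx : (xZ + cK K b) * Q.eval₂ ((unitBall K).subtype.comp (algebraMap A (unitBall K))) (X₀ + cK K b) =
      P.eval₂ ((unitBall K).subtype.comp (algebraMap A (unitBall K))) (X₀ + cK K b))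
    (hZy : cK K α * (2 * yZ + cK K W.a₁ * xZ + cK K W.a₃) * Q.eval₂ ((unitBall K).subtype.comp (algebraMap A (unitBall K))) (X₀ + cK K b) +
        (xZ + cK K b) * (Polynomial.derivative Q).eval₂ ((unitBall K).subtype.comp (algebraMap A (unitBall K))) (X₀ + cK K b) *
          (2 * Y₀ + cK K W.a₁ * X₀ + cK K W.a₃) =
      (Polynomial.derivative P).eval₂ ((unitBall K).subtype.comp (algebraMap A (unitBall K))) (X₀ + cK K b) *
        (2 * Y₀ + cK K W.a₁ * X₀ + cK K W.a₃)) :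
    (.some (cK K x₁) (cK K y₁) h₁ : (curveOver K W).toAffine.Point) + ptOfZ K W (evalPt₁ (ballNilIdeal K) T hT t) =
      .some xZ yZ hZ := by
  -- abbreviations
  set φ : A →+* K := (unitBall K).subtype.comp (algebraMap A (unitBall K)) with hφ
  set s : (ballNilIdeal K).toIdeal := evalPt₁ (ballNilIdeal K) T hT t with hs
  -- the coordinates of `P₁ ⊕ P(t)` are the translate values
  obtain ⟨h₃, e₀⟩ := some_add_ptOfZ (W := W) h₀ ht0
  have hXY := e₀.symm.trans hsum
  simp only [Affine.Point.some.injEq] at hXY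
  obtain ⟨hX0, hY0⟩ := hXY
  have hXb : ((evalAt (ballNilIdeal K) t (W.translateX x₀ y₀) : unitBall K) : K) + ((algebraMap A (unitBall K) b : unitBall K) : K) =
      X₀ + cK K b := by
    rw [hX0]; rfl
  -- the coordinates of `P₁^α ⊕ P(T t)`
  obtain ⟨h₄, e₁⟩ := some_add_ptOfZ (W := W) h₁ hTt0
  set X₁ : K := ((evalAt (ballNilIdeal K) s (W.translateX x₁ y₁) : unitBall K) : K) with hX₁
  set Y₁ : K := ((evalAt (ballNilIdeal K) s (W.translateY x₁ y₁) : unitBall K) : K) with hY₁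
  -- CMF-pt: the `x`-identity at `t`
  have ex : (X₁ + cK K b) * Q.eval₂ φ (X₀ + cK K b) = P.eval₂ φ (X₀ + cK K b) := by
    have h := coe_evalAt_translateX_subst_add_mul_eval_eq (K := K) (W := W) hT hidX t
    rw [coe_eval₂_map_subtype, coe_eval₂_map_subtype, hXb] at h
    exact h
  -- CM-ptY: the `y`-identity at `t`
  have ey : cK K α * (2 * Y₁ + cK K W.a₁ * X₁ + cK K W.a₃) * Q.eval₂ φ (X₀ + cK K b) +
      (X₁ + cK K b) * (Polynomial.derivative Q).eval₂ φ (X₀ + cK K b) * (2 * Y₀ + cK K W.a₁ * X₀ + cK K W.a₃) =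
      (Polynomial.derivative P).eval₂ φ (X₀ + cK K b) * (2 * Y₀ + cK K W.a₁ * X₀ + cK K W.a₃) := by
    have h := congrArg (fun u : unitBall K => (u : K))
      (evalAt_cmY_identity (K := K) (X₀ := W.translateX x₀ y₀) (Y₀ := W.translateY x₀ y₀) (X₁ := W.translateX x₁ y₁)
        (Y₁ := W.translateY x₁ y₁) hT hidY t)
    simp only [Subring.coe_mul, Subring.coe_add, coe_aeval_unitBall, coe_eval₂_map_subtype, hY0, hX0] at h
    exact h
  -- solve for `x`, then `ỹ`, then `y`
  have hx : X₁ = xZ := by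
    have h := ex.trans hZx.symm
    exact add_right_cancel (mul_right_cancel₀ hQ h)
  rw [hx] at ey
  have hy : Y₁ = yZ := by
    have h : cK K α * Q.eval₂ φ (X₀ + cK K b) * (2 * (Y₁ - yZ)) = 0 := by linear_combination ey - hZy
    rcases mul_eq_zero.mp h with h' | h'
    · rcases mul_eq_zero.mp h' with h'' | h''
      · exact absurd h'' hα
      · exact absurd h'' hQ
    · rcases mul_eq_zero.mp h' with h'' | h''
      · exact absurd h'' h2
      · exact sub_eq_zero.mp h''
  rw [e₁]
  simp only [Affine.Point.some.injEq]
  exact ⟨hx, hy⟩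

/-- **`P(T t) = Z − P₁^α`** (the solved form of `some_add_ptOfZ_evalPt₁_eq_of_cm_identities`): with `Z = ι_v ξ(α(Ω₁ + u))`,
`P₁^α = ι_v ξ(αΩ₁)` this reads `P(T(z(ι_v ξ u))) = ι_v ξ(αu)` — the formal multiplication `T` computes the algebraic one on `E₁(K)`.
[cite: deShalit1987, II §4.4 (iv), II §4.9 Proposition (ii)] [cite: SilvermanATAEC1994, II Prop. 1.1] -/
theorem ptOfZ_evalPt₁_eq_sub_of_cm_identities {x₀ y₀ x₁ y₁ b α : A} {T : PowerSeries A} (hT : constantCoeff T = 0)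
    {P Q : Polynomial A}
    (hidX : ((W.translateX x₁ y₁).subst T + C b) * Polynomial.aeval (W.translateX x₀ y₀ + C b) Q =
      Polynomial.aeval (W.translateX x₀ y₀ + C b) P)
    (hidY : C α * (2 * PowerSeries.subst T (W.translateY x₁ y₁) + C W.a₁ * PowerSeries.subst T (W.translateX x₁ y₁) + C W.a₃) *
          Polynomial.aeval (W.translateX x₀ y₀ + C b) Q +
        (PowerSeries.subst T (W.translateX x₁ y₁) + C b) * Polynomial.aeval (W.translateX x₀ y₀ + C b) (Polynomial.derivative Q) *
          (2 * W.translateY x₀ y₀ + C W.a₁ * W.translateX x₀ y₀ + C W.a₃) =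
      Polynomial.aeval (W.translateX x₀ y₀ + C b) (Polynomial.derivative P) *
        (2 * W.translateY x₀ y₀ + C W.a₁ * W.translateX x₀ y₀ + C W.a₃))
    (h₀ : (curveOver K W).toAffine.Nonsingular (cK K x₀) (cK K y₀)) (h₁ : (curveOver K W).toAffine.Nonsingular (cK K x₁) (cK K y₁))
    {t : (ballNilIdeal K).toIdeal} (ht0 : ((t : unitBall K) : K) ≠ 0)
    (hTt0 : (((evalPt₁ (ballNilIdeal K) T hT t : (ballNilIdeal K).toIdeal) : unitBall K) : K) ≠ 0)
    {X₀ Y₀ : K} {hS : (curveOver K W).toAffine.Nonsingular X₀ Y₀}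
    (hsum : (.some (cK K x₀) (cK K y₀) h₀ : (curveOver K W).toAffine.Point) + ptOfZ K W t = .some X₀ Y₀ hS)
    {xZ yZ : K} (hZ : (curveOver K W).toAffine.Nonsingular xZ yZ)
    (hQ : Q.eval₂ ((unitBall K).subtype.comp (algebraMap A (unitBall K))) (X₀ + cK K b) ≠ 0)
    (hα : cK K α ≠ 0) (h2 : (2 : K) ≠ 0)
    (hZx : (xZ + cK K b) * Q.eval₂ ((unitBall K).subtype.comp (algebraMap A (unitBall K))) (X₀ + cK K b) =
      P.eval₂ ((unitBall K).subtype.comp (algebraMap A (unitBall K))) (X₀ + cK K b))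
    (hZy : cK K α * (2 * yZ + cK K W.a₁ * xZ + cK K W.a₃) * Q.eval₂ ((unitBall K).subtype.comp (algebraMap A (unitBall K))) (X₀ + cK K b) +
        (xZ + cK K b) * (Polynomial.derivative Q).eval₂ ((unitBall K).subtype.comp (algebraMap A (unitBall K))) (X₀ + cK K b) *
          (2 * Y₀ + cK K W.a₁ * X₀ + cK K W.a₃) =
      (Polynomial.derivative P).eval₂ ((unitBall K).subtype.comp (algebraMap A (unitBall K))) (X₀ + cK K b) *
        (2 * Y₀ + cK K W.a₁ * X₀ + cK K W.a₃)) :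
    ptOfZ K W (evalPt₁ (ballNilIdeal K) T hT t) =
      .some xZ yZ hZ - (.some (cK K x₁) (cK K y₁) h₁ : (curveOver K W).toAffine.Point) :=
  eq_sub_of_add_eq' (some_add_ptOfZ_evalPt₁_eq_of_cm_identities hT hidX hidY h₀ h₁ ht0 hTt0 hsum hZ hQ hα h2 hZx hZy)

end Chart

/-! ## §3 Appended (g15): the degenerate parameter `T t = 0` — the `x`-identity alone pins `x(Z) = x(P₁^α)` -/

section Degenerate

variable {A : Type*} [CommRing A] [UniformSpace A] [DiscreteUniformity A]
  {K : Type*} [NontriviallyNormedField K] [IsUltrametricDist K] [CompleteSpace K]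
  [Algebra A (unitBall K)] [ContinuousSMul A (unitBall K)] {W : WeierstrassCurve A}

/-- **The value of `h ∈ A⟦X⟧` at a parameter with value `0` is its constant term** (`‖h(t) − h(0)‖ ≤ ‖t‖ = 0`).
[cite: SilvermanAEC2009, IV.1] -/
theorem coe_evalAt_eq_cK_constantCoeff_of_coe_eq_zero {t : (ballNilIdeal K).toIdeal} (ht : ((t : unitBall K) : K) = 0)
    (h : PowerSeries A) : ((evalAt (ballNilIdeal K) t h : unitBall K) : K) = cK K (constantCoeff h) := by
  have h1 := norm_evalAt_le_of_constantCoeff t (h := h - C (constantCoeff h)) (by rw [map_sub, constantCoeff_C, sub_self])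
  rw [ht, norm_zero, map_sub, evalAt_C', AddSubgroupClass.coe_sub] at h1
  exact sub_eq_zero.mp (norm_le_zero_iff.mp h1)

variable [hE : (curveOver K W).IsElliptic]

/-- ★ **The degenerate case `T(t) = 0` of `some_add_ptOfZ_evalPt₁_eq_of_cm_identities`: `x(Z) = x(P₁^α)`.**  If the parameter `T t` has value
`0` (so `P(T t) = O` and `P₁^α ⊕ P(T t) = P₁^α`), the `x`-identity of `CMFormalActionNilIdealPoints` still holds at `t` and reads
`(x₁ + b)·Q(X₀ + b) = P(X₀ + b)` (`x(P₁^α ⊕ O) = x₁`, the constant term of `translateX`); with the `x`-identity of `Z` and `Q(X₀ + b) ≠ 0` this gives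
`x_Z = x₁`, i.e. `Z = ±P₁^α` (`Affine.Point.X_eq_iff`).  Used in the cell's torsion-structure step (N1) for the `[π]`-torsion of the formal group
(`T(z X) = 0`), where `Z − P₁^α = [π]X̃` is `2`-power torsion and `P₁^α` has odd order, forcing `[π]X̃ = O`.
[cite: deShalit1987, II §4.4 (iv), II §4.9 (ii)] [cite: SilvermanATAEC1994, II Prop. 1.1] -/
theorem eq_cK_of_cm_identity_of_coe_evalPt₁_eq_zero {x₀ y₀ x₁ y₁ b : A} {T : PowerSeries A} (hT : constantCoeff T = 0)
    {P Q : Polynomial A}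
    (hidX : ((W.translateX x₁ y₁).subst T + C b) * Polynomial.aeval (W.translateX x₀ y₀ + C b) Q =
      Polynomial.aeval (W.translateX x₀ y₀ + C b) P)
    (h₀ : (curveOver K W).toAffine.Nonsingular (cK K x₀) (cK K y₀))
    {t : (ballNilIdeal K).toIdeal} (ht0 : ((t : unitBall K) : K) ≠ 0)
    (hTt0 : (((evalPt₁ (ballNilIdeal K) T hT t : (ballNilIdeal K).toIdeal) : unitBall K) : K) = 0)
    {X₀ Y₀ : K} {hS : (curveOver K W).toAffine.Nonsingular X₀ Y₀}
    (hsum : (.some (cK K x₀) (cK K y₀) h₀ : (curveOver K W).toAffine.Point) + ptOfZ K W t = .some X₀ Y₀ hS)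
    {xZ : K} (hQ : Q.eval₂ ((unitBall K).subtype.comp (algebraMap A (unitBall K))) (X₀ + cK K b) ≠ 0)
    (hZx : (xZ + cK K b) * Q.eval₂ ((unitBall K).subtype.comp (algebraMap A (unitBall K))) (X₀ + cK K b) =
      P.eval₂ ((unitBall K).subtype.comp (algebraMap A (unitBall K))) (X₀ + cK K b)) :
    xZ = cK K x₁ := by
  obtain ⟨h₃, e₀⟩ := some_add_ptOfZ (W := W) h₀ ht0
  have hXY := e₀.symm.trans hsum
  simp only [Affine.Point.some.injEq] at hXY
  obtain ⟨hX0, -⟩ := hXY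
  have hXb : ((evalAt (ballNilIdeal K) t (W.translateX x₀ y₀) : unitBall K) : K) + ((algebraMap A (unitBall K) b : unitBall K) : K) =
      X₀ + cK K b := by
    rw [hX0]; rfl
  have ex : (cK K x₁ + cK K b) * Q.eval₂ ((unitBall K).subtype.comp (algebraMap A (unitBall K))) (X₀ + cK K b) =
      P.eval₂ ((unitBall K).subtype.comp (algebraMap A (unitBall K))) (X₀ + cK K b) := by
    have h := coe_evalAt_translateX_subst_add_mul_eval_eq (K := K) (W := W) hT hidX t
    rw [coe_eval₂_map_subtype, coe_eval₂_map_subtype, hXb, coe_evalAt_eq_cK_constantCoeff_of_coe_eq_zero hTt0,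
      constantCoeff_translateX] at h
    exact h
  exact add_right_cancel (mul_right_cancel₀ hQ (hZx.trans ex.symm))

end Degenerate

end Literature.NumberTheory.EllipticCurves

end
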